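import Summits.KontsevichZagierPeriods.KontsevichZagierPeriods.Theorems.TerasomaMultiplicationBetaCancellationAEConstAlgebraic
import Summits.KontsevichZagierPeriods.KontsevichZagierPeriods.Theorems.TerasomaMultiplicationBetaCancellationFibreSubstitutionTwoCatalysts
import Literature.NumberTheory.Transcendental.KZTorusLogRep

/-!
# `BetaCancellation` (stmt-KontsevichZagierPeriods-13633), line `dirichlet-companion-to-pi` — stub `stub_catalystRatio_isAlgebraic` (seat c15): SCALED A.E. JACOBIAN IDENTITIES

**The arithmetic and the bookkeeping of one-move certificates.** A one-move change of variables
between pinned products forces, after Fubini over the catalyst, a SCALED a.e. rule-(2) identity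
`c · f = (f' ∘ ψ) · |det ψ'|` between the `ℚ`-semialgebraic base integrands, the scale `c` being a
ratio of catalyst masses (a period). This file collects what such an identity yields:

* `isAlgebraic_of_ae_scaledJacobian` — if the base is not null, the scale `c` is ALGEBRAIC over `ℚ`
  (`c` is the a.e. value of the `ℚ`-semialgebraic function `(f' ∘ ψ)|det (fderiv ψ)| / f` on the
  non-null set `interior σ ∩ {f ≠ 0}`; `isAlgebraic_of_ae_eq_const`, module `…AEConstAlgebraic`);
* `equivalent_of_ae_jacobian` — an UNSCALED a.e. identity with `r₂.domain = ψ σ` is an equivalence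
  `r₁ ∼ r₂` (interior reduction + seat c14's `stub_equivalent_of_aeJacobian`; the assembly of
  `stub_fibreSubstitutionTwoCatalysts` as a lemma);
* `of_mem_relations_of_volume_sep_ne_zero_eq_zero` — a representation whose integrand vanishes off a
  null set is a relation; `volume_image_sep_ne_zero_eq_zero` — where `(f' ∘ ψ)|det ψ'| = 0` a.e.
  (e.g. a scaled identity over a null base), `f'` vanishes a.e. on the image `ψ σ` (area inequality);
* `stub_catalystRatio_isAlgebraic` — in seat c14's catalyst exchange
  (`stub_fibreSubstitutionTwoCatalysts`: `p₁ ⊗ r → p₂ ⊗ r'` by one fibre-form substitution,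
  `c · p₂.value = p₁.value`) the hypothesis "`c` algebraic" is AUTOMATIC unless `r` is null.

Consequence: ONE fibre-form substitution relates `p₁ ⊗ r` to `p₂ ⊗ r'` only if
`p₁.value / p₂.value ∈ ℚ̄` or `r` is null — (disc segment) `⊗ r` is never one fibre-form move away
from (disc) `⊗ r'`, and the "transcendental catalyst fraction" certificates of the crux notes
(c14 K5 (iv), K7, K8 (vi)) do not exist. No definitions; sorry-free;
axioms ⊆ {propext, Classical.choice, Quot.sound}.

References: M. Kontsevich, D. Zagier, *Periods* (2001), §1.2 rules (1), (2); J. Bochnak, M. Coste,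
M.-F. Roy, *Real Algebraic Geometry* (1998), §2.8.
-/

noncomputable section

-- `Summit.KontsevichZagierPeriods.KontsevichZagierPeriods.…` is the tree's mandated layout (single-conjunct summit).
set_option linter.dupNamespace false

namespace Summit.KontsevichZagierPeriods.KontsevichZagierPeriods.BetaCancellationLine

open MeasureTheory Set
open Literature.ModelTheory.ExponentialFields (IsSemialgebraic isSemialgebraic_interior
  isSemialgebraic_diff_interior)
open Literature.NumberTheory.Transcendental
open Literature.NumberTheory.Transcendental.KZ

/-! ### The scale of a scaled a.e. Jacobian identity is algebraic -/

/-- **Scaled a.e. Jacobian identities have algebraic scale.** If `ψ` is `ℚ`-semialgebraic on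
`r.domain`, maps it into `r'.domain` and has a derivative `ψ'` within it, and the scaled rule-(2)
identity `c · f = (f' ∘ ψ) · |det ψ'|` holds almost everywhere on `r.domain` (`f`, `f'` the two
integrands) while `{w ∈ r.domain | f w ≠ 0}` is not null, then `c` is algebraic over `ℚ`: on the
interior `U` of `r.domain` (co-null) `ψ' = fderiv ψ` has a `ℚ`-semialgebraic Jacobian
(`stub_absDetFDeriv_semialgebraic`), so `c` is the a.e. value of the `ℚ`-semialgebraic function
`(f' ∘ ψ)|det ψ'| / f` on the non-null `ℚ`-semialgebraic set `U ∩ {f ≠ 0}`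
(`isAlgebraic_of_ae_eq_const`). [cite: BochnakCosteRoy1998, §2.8] -/
theorem isAlgebraic_of_ae_scaledJacobian {n : ℕ} (r r' : IntegralRep n) (c : ℝ)
    (ψ : (Fin n → ℝ) → (Fin n → ℝ)) (ψ' : (Fin n → ℝ) → (Fin n → ℝ) →L[ℝ] (Fin n → ℝ))
    (hψsa : IsSemialgebraicMapOn ℚ r.domain ψ) (hmaps : MapsTo ψ r.domain r'.domain)
    (hψ' : ∀ w ∈ r.domain, HasFDerivWithinAt ψ (ψ' w) r.domain w)
    (hae : ∀ᵐ w ∂(volume.restrict r.domain),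
      c * r.integrand w = r'.integrand (ψ w) * |(ψ' w).det|)
    (hr : volume {w | w ∈ r.domain ∧ r.integrand w ≠ 0} ≠ 0) :
    IsAlgebraic ℚ c := by
  -- (1) the interior `U` of `σ` (co-null) and the semialgebraic Jacobian on it
  set U : Set (Fin n → ℝ) := interior r.domain with hU
  have hUσ : U ⊆ r.domain := interior_subset
  have hUs : IsSemialgebraic ℚ U := isSemialgebraic_interior r.isSemialgebraic_domain
  have hUo : IsOpen U := isOpen_interior
  have hU0 : volume (r.domain \ U) = 0 :=
    volume_eq_zero_of_interior_eq_empty (isSemialgebraic_diff_interior r.isSemialgebraic_domain).1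
      (isSemialgebraic_diff_interior r.isSemialgebraic_domain).2
  have hfd : ∀ w ∈ U, HasFDerivAt ψ (ψ' w) w := fun w hw =>
    (hψ' w (hUσ hw)).hasFDerivAt (mem_interior_iff_mem_nhds.1 hw)
  have hdet : IsSemialgebraicFunOn ℚ U fun w => |(ψ' w).det| :=
    (stub_absDetFDeriv_semialgebraic hUo hUs ψ (hψsa.mono hUσ hUs)
      fun w hw => (hfd w hw).differentiableAt).congr fun w hw => by
        show |(fderiv ℝ ψ w).det| = _
        rw [(hfd w hw).fderiv]
  -- (2) the non-vanishing set of `f` inside `U` is semialgebraic and not null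
  set S : Set (Fin n → ℝ) := {w | w ∈ U ∧ r.integrand w ≠ 0} with hS_def
  have hfU : IsSemialgebraicFunOn ℚ U r.integrand := r.isSemialgebraicFunOn_integrand.mono hUσ hUs
  have hSs : IsSemialgebraic ℚ S := hfU.isSemialgebraic_sep_ne_zero
  have hSm : MeasurableSet S := IsSemialgebraic.measurableSet_holds hSs
  have hSU : S ⊆ U := fun w hw => hw.1
  have hSvol : volume S ≠ 0 := by
    intro h0
    apply hr
    have hsub : {w | w ∈ r.domain ∧ r.integrand w ≠ 0} ⊆ S ∪ (r.domain \ U) := by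
      intro w hw
      by_cases hwU : w ∈ U
      · exact Or.inl ⟨hwU, hw.2⟩
      · exact Or.inr ⟨hw.1, hwU⟩
    exact measure_mono_null hsub (measure_union_null h0 hU0)
  -- (3) the ratio `(f' ∘ ψ)|det ψ'| / f` is `ℚ`-semialgebraic on `S` and equals `c` a.e. there
  have hg : IsSemialgebraicFunOn ℚ S fun w => r'.integrand (ψ w) * |(ψ' w).det| / r.integrand w := by
    have hcomp : IsSemialgebraicFunOn ℚ S (r'.integrand ∘ ψ) :=
      IsSemialgebraicFunOn.comp_isSemialgebraicMapOn_holds r'.isSemialgebraicFunOn_integrand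
        (hψsa.mono (hSU.trans hUσ) hSs) (hmaps.mono_left (hSU.trans hUσ))
    exact ((IsSemialgebraicFunOn.mul_holds hcomp (hdet.mono hSU hSs)).div (hfU.mono hSU hSs)
      fun w hw => hw.2).congr fun w _ => rfl
  have haeS : ∀ᵐ w ∂(volume.restrict S),
      r'.integrand (ψ w) * |(ψ' w).det| / r.integrand w = c := by
    have h1 : ∀ᵐ w ∂(volume.restrict S), c * r.integrand w = r'.integrand (ψ w) * |(ψ' w).det| :=
      ae_restrict_of_ae_restrict_of_subset (hSU.trans hUσ) hae
    filter_upwards [h1, ae_restrict_mem hSm] with w hw hwS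
    rw [← hw]
    exact mul_div_cancel_right₀ c hwS.2
  -- (4) an a.e.-constant semialgebraic function has an algebraic value
  exact isAlgebraic_of_ae_eq_const hg Subset.rfl hSm hSvol haeS

/-! ### An unscaled a.e. Jacobian identity onto the image is an equivalence -/

/-- **Descent of an a.e. Jacobian identity.** If `ψ` is `ℚ`-semialgebraic and injective on
`r₁.domain` with a derivative `ψ'` within it, `r₂.domain = ψ '' r₁.domain`, and
`f₁ = (f₂ ∘ ψ) · |det ψ'|` holds almost everywhere on `r₁.domain`, then `r₁ ∼ r₂`: pass to the
interior `U` of `r₁.domain` (co-null, `IntegralRep.of_sub_of_restrict_mem_relations`; the image of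
the null difference is null by the area inequality, `aeJacobian_volume_image_null`), where
`ψ' = fderiv ψ` has a `ℚ`-semialgebraic Jacobian (`stub_absDetFDeriv_semialgebraic`), and apply seat
c14's bookkeeping `stub_equivalent_of_aeJacobian`. (The assembly of `stub_fibreSubstitutionTwoCatalysts`,
as a lemma.) [cite: KontsevichZagier2001, §1.2 rule (2)] -/
theorem equivalent_of_ae_jacobian {n : ℕ} (r₁ r₂ : IntegralRep n)
    (ψ : (Fin n → ℝ) → (Fin n → ℝ)) (ψ' : (Fin n → ℝ) → (Fin n → ℝ) →L[ℝ] (Fin n → ℝ))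
    (hψsa : IsSemialgebraicMapOn ℚ r₁.domain ψ)
    (hψ' : ∀ w ∈ r₁.domain, HasFDerivWithinAt ψ (ψ' w) r₁.domain w) (hψinj : Set.InjOn ψ r₁.domain)
    (himg : r₂.domain = ψ '' r₁.domain)
    (hae : ∀ᵐ w ∂(volume.restrict r₁.domain),
      r₁.integrand w = r₂.integrand (ψ w) * |(ψ' w).det|) :
    Equivalent r₁ r₂ := by
  have hσm : MeasurableSet r₁.domain := IntegralRep.measurableSet_domain_holds r₁
  -- (1) pass to the interior `U` of `σ`
  set U : Set (Fin n → ℝ) := interior r₁.domain with hU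
  have hUσ : U ⊆ r₁.domain := interior_subset
  have hUs : IsSemialgebraic ℚ U := isSemialgebraic_interior r₁.isSemialgebraic_domain
  have hUo : IsOpen U := isOpen_interior
  have hU0 : volume (r₁.domain \ U) = 0 :=
    volume_eq_zero_of_interior_eq_empty (isSemialgebraic_diff_interior r₁.isSemialgebraic_domain).1
      (isSemialgebraic_diff_interior r₁.isSemialgebraic_domain).2
  set r₀ : IntegralRep n := r₁.restrict U hUs hUσ with hr₀
  have h1 : of r₁ - of r₀ ∈ relations := IntegralRep.of_sub_of_restrict_mem_relations r₁ hUs hUσ hU0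
  -- (2) the image side
  have hψU : IsSemialgebraic ℚ (ψ '' U) :=
    IsSemialgebraicMapOn.isSemialgebraic_image_holds hψsa hUσ hUs
  have hψUσ' : ψ '' U ⊆ r₂.domain := himg ▸ image_mono hUσ
  set r'₀ : IntegralRep n := r₂.restrict (ψ '' U) hψU hψUσ' with hr'₀
  have h2 : of r₂ - of r'₀ ∈ relations := by
    refine IntegralRep.of_sub_of_restrict_mem_relations r₂ hψU hψUσ' ?_
    have hsub : r₂.domain \ ψ '' U ⊆ ψ '' (r₁.domain \ U) := by
      intro w' hw'
      rw [himg] at hw'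
      obtain ⟨⟨w, hw, rfl⟩, hnot⟩ := hw'
      exact ⟨w, ⟨hw, fun hwU => hnot (mem_image_of_mem ψ hwU)⟩, rfl⟩
    exact measure_mono_null hsub (aeJacobian_volume_image_null ψ ψ' hψ' (fun _ h => h.1)
      (hσm.diff hUo.measurableSet) hU0)
  -- (3) on `U`, `ψ' = fderiv ℝ ψ`, so `|det ψ'|` is semialgebraic there
  have hfd : ∀ w ∈ U, HasFDerivAt ψ (ψ' w) w := fun w hw =>
    (hψ' w (hUσ hw)).hasFDerivAt (mem_interior_iff_mem_nhds.1 hw)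
  have hdet : IsSemialgebraicFunOn ℚ U fun w => |(ψ' w).det| :=
    (stub_absDetFDeriv_semialgebraic hUo hUs ψ (hψsa.mono hUσ hUs)
      fun w hw => (hfd w hw).differentiableAt).congr fun w hw => by
        show |(fderiv ℝ ψ w).det| = _
        rw [(hfd w hw).fderiv]
  -- (4) the bookkeeping stub on the restricted representations
  have h3 : Equivalent r₀ r'₀ := by
    refine stub_equivalent_of_aeJacobian r₀ r'₀ ψ ψ' (hψsa.mono hUσ hUs)
      (fun w hw => (hψ' w (hUσ hw)).mono hUσ) (hψinj.mono hUσ) rfl hdet ?_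
    have := (ae_restrict_of_ae_restrict_of_subset hUσ hae)
    simpa [hr₀, hr'₀] using this
  -- (5) assemble
  have h123 : of r₁ - of r₂ = (of r₁ - of r₀) + (of r₀ - of r'₀) - (of r₂ - of r'₀) := by abel
  change of r₁ - of r₂ ∈ relations
  rw [h123]
  exact relations.sub_mem (relations.add_mem h1 h3) h2

/-! ### Null representations are relations; null bases have null images -/

/-- A representation whose integrand vanishes off a NULL subset of its domain is a relation: restrict
to the `ℚ`-semialgebraic zero set of the integrand (co-null restriction,
`IntegralRep.of_sub_of_restrict_mem_relations`) and use a zero-integrand representation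
(`KZ.of_mem_relations_of_eqOn_zero`). [cite: KontsevichZagier2001, §1.2 rule (1)] -/
theorem of_mem_relations_of_volume_sep_ne_zero_eq_zero {n : ℕ} (r : IntegralRep n)
    (h : volume {w | w ∈ r.domain ∧ r.integrand w ≠ 0} = 0) : of r ∈ relations := by
  set E : Set (Fin n → ℝ) := {w | w ∈ r.domain ∧ r.integrand w = 0} with hE
  have hEs : IsSemialgebraic ℚ E := r.isSemialgebraicFunOn_integrand.isSemialgebraic_sep_eq_zero
  have hEσ : E ⊆ r.domain := fun w hw => hw.1
  have hvol : volume (r.domain \ E) = 0 := by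
    have hset : r.domain \ E = {w | w ∈ r.domain ∧ r.integrand w ≠ 0} := by
      ext w
      simp only [mem_sdiff, mem_setOf_eq, hE, not_and]
      exact ⟨fun hw => ⟨hw.1, hw.2 hw.1⟩, fun hw => ⟨hw.1, fun _ => hw.2⟩⟩
    rw [hset]
    exact h
  have h1 : of r - of (r.restrict E hEs hEσ) ∈ relations :=
    r.of_sub_of_restrict_mem_relations hEs hEσ hvol
  have h2 : of (r.restrict E hEs hEσ) ∈ relations :=
    of_mem_relations_of_eqOn_zero _ fun w hw => hw.2
  have heq : of r = (of r - of (r.restrict E hEs hEσ)) + of (r.restrict E hEs hEσ) := by abel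
  rw [heq]
  exact relations.add_mem h1 h2

/-- **Where the Jacobian side of an a.e. identity vanishes, the image is null.** If `ψ` is
`ℚ`-semialgebraic on `r.domain`, maps it into `r'.domain`, has a derivative `ψ'` within it, and
`(f' ∘ ψ) · |det ψ'| = 0` almost everywhere on `r.domain` (e.g. a scaled identity
`c · f = (f' ∘ ψ)|det ψ'|` over a null base `f = 0` a.e.), then the set
`ψ {w ∈ r.domain | f' (ψ w) ≠ 0}` is null: on it `|det ψ'| = 0` a.e., and the area inequality
`MeasureTheory.addHaar_image_le_lintegral_abs_det_fderiv` bounds the measure of the image by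
`∫ |det ψ'| = 0`. [cite: KontsevichZagier2001, §1.2 rule (2)] -/
theorem volume_image_sep_ne_zero_eq_zero {n : ℕ} (r r' : IntegralRep n)
    (ψ : (Fin n → ℝ) → (Fin n → ℝ)) (ψ' : (Fin n → ℝ) → (Fin n → ℝ) →L[ℝ] (Fin n → ℝ))
    (hψsa : IsSemialgebraicMapOn ℚ r.domain ψ) (hmaps : MapsTo ψ r.domain r'.domain)
    (hψ' : ∀ w ∈ r.domain, HasFDerivWithinAt ψ (ψ' w) r.domain w)
    (hzero : ∀ᵐ w ∂(volume.restrict r.domain), r'.integrand (ψ w) * |(ψ' w).det| = 0) :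
    volume (ψ '' {w | w ∈ r.domain ∧ r'.integrand (ψ w) ≠ 0}) = 0 := by
  set A : Set (Fin n → ℝ) := {w | w ∈ r.domain ∧ r'.integrand (ψ w) ≠ 0} with hA
  have hAσ : A ⊆ r.domain := fun w hw => hw.1
  have hcomp : IsSemialgebraicFunOn ℚ r.domain (r'.integrand ∘ ψ) :=
    IsSemialgebraicFunOn.comp_isSemialgebraicMapOn_holds r'.isSemialgebraicFunOn_integrand hψsa hmaps
  have hAs : IsSemialgebraic ℚ A := hcomp.isSemialgebraic_sep_ne_zero
  have hAm : MeasurableSet A := IsSemialgebraic.measurableSet_holds hAs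
  have hle := addHaar_image_le_lintegral_abs_det_fderiv volume hAm
    (fun w hw => (hψ' w (hAσ hw)).mono hAσ) (f' := ψ')
  have hzero' : ∀ᵐ w ∂(volume.restrict A), ENNReal.ofReal |(ψ' w).det| = 0 := by
    have h1 : ∀ᵐ w ∂(volume.restrict A), r'.integrand (ψ w) * |(ψ' w).det| = 0 :=
      ae_restrict_of_ae_restrict_of_subset hAσ hzero
    filter_upwards [h1, ae_restrict_mem hAm] with w hw1 hwA
    have hdet : |(ψ' w).det| = 0 := by
      rcases mul_eq_zero.1 hw1 with h | h
      · exact absurd h hwA.2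
      · exact h
    rw [hdet, ENNReal.ofReal_zero]
  rw [lintegral_congr_ae hzero', lintegral_zero] at hle
  exact nonpos_iff_eq_zero.1 hle

/-! ### The stub: catalyst value ratios forced by one fibre-form substitution are algebraic -/

/-- STUB (seat c15). **The value ratio of a catalyst exchange is algebraic.** In the situation of
`stub_fibreSubstitutionTwoCatalysts` WITHOUT the hypothesis that `c` is algebraic — `q = p₁ ⊗ r`,
`q' = p₂ ⊗ r'` pinned products over catalysts of the same dimension and non-zero values, ONE change of
variables `Φ : q → q'` of fibre form over a `ℚ`-semialgebraic substitution `ψ` injective on `r.domain`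
with a derivative within it, and `c · p₂.value = p₁.value` — the constant `c` is ALGEBRAIC over `ℚ` as
soon as the base `r` is not null (`{w ∈ r.domain | r.integrand w ≠ 0}` of non-zero measure): the a.e.
identity `c · f = (f' ∘ ψ)|det ψ'|` (`stub_fibreSubstitutionTwoCatalystsAE`) has algebraic scale
(`isAlgebraic_of_ae_scaledJacobian`). So ONE fibre-form substitution relates `p₁ ⊗ r` to `p₂ ⊗ r'`
only if `p₁.value / p₂.value ∈ ℚ̄` or `r` is null — a disc SEGMENT times `r` is never one fibre-form
move away from a disc product, and the algebraicity hypothesis of the catalyst-exchange theorem is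
automatic. [cite: KontsevichZagier2001, §1.2 rule (2)] -/
theorem stub_catalystRatio_isAlgebraic {d n : ℕ} (p₁ p₂ : IntegralRep d) (hp₁ : p₁.value ≠ 0)
    (hp₂ : p₂.value ≠ 0) (c : ℝ) (hcv : c * p₂.value = p₁.value)
    (r r' : IntegralRep n) (q q' : IntegralRep (d + n))
    (hq : q.domain = {z | (fun i => z (Fin.castAdd n i)) ∈ p₁.domain ∧
      (fun j => z (Fin.natAdd d j)) ∈ r.domain})
    (hqi : Set.EqOn q.integrand (fun z => p₁.integrand (fun i => z (Fin.castAdd n i)) *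
      r.integrand (fun j => z (Fin.natAdd d j))) q.domain)
    (hq' : q'.domain = {z | (fun i => z (Fin.castAdd n i)) ∈ p₂.domain ∧
      (fun j => z (Fin.natAdd d j)) ∈ r'.domain})
    (hq'i : Set.EqOn q'.integrand (fun z => p₂.integrand (fun i => z (Fin.castAdd n i)) *
      r'.integrand (fun j => z (Fin.natAdd d j))) q'.domain)
    (Φ : (Fin (d + n) → ℝ) → (Fin (d + n) → ℝ))
    (Φ' : (Fin (d + n) → ℝ) → (Fin (d + n) → ℝ) →L[ℝ] (Fin (d + n) → ℝ))
    (hΦ' : ∀ z ∈ q.domain, HasFDerivWithinAt Φ (Φ' z) q.domain z) (hΦinj : Set.InjOn Φ q.domain)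
    (himg : q'.domain = Φ '' q.domain)
    (hjac : ∀ z ∈ q.domain, q.integrand z = q'.integrand (Φ z) * |(Φ' z).det|)
    (ψ : (Fin n → ℝ) → (Fin n → ℝ)) (ψ' : (Fin n → ℝ) → (Fin n → ℝ) →L[ℝ] (Fin n → ℝ))
    (hψsa : IsSemialgebraicMapOn ℚ r.domain ψ)
    (hfib : ∀ z ∈ q.domain, (fun j => Φ z (Fin.natAdd d j)) = ψ (fun j => z (Fin.natAdd d j)))
    (hψ' : ∀ w ∈ r.domain, HasFDerivWithinAt ψ (ψ' w) r.domain w) (hψinj : Set.InjOn ψ r.domain)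
    (hr : volume {w | w ∈ r.domain ∧ r.integrand w ≠ 0} ≠ 0) :
    IsAlgebraic ℚ c := by
  -- (0) the a.e. rule-(2) identity on `σ := r.domain` (measure core, seat c14)
  have hae := stub_fibreSubstitutionTwoCatalystsAE p₁ p₂ hp₁ hp₂ c hcv r r' q q' hq hqi hq' hq'i
    Φ Φ' hΦ' hΦinj himg hjac ψ ψ' hfib hψ' hψinj
  -- (1) `ψ` maps `σ` into `σ'` (push a point `(x₀, w)` through `Φ`)
  have hKne : p₁.domain.Nonempty := by
    by_contra h
    apply hp₁
    rw [not_nonempty_iff_eq_empty] at h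
    simp [IntegralRep.value, h]
  obtain ⟨x₀, hx₀⟩ := hKne
  have hmemq : ∀ z, z ∈ q.domain ↔ (fun i => z (Fin.castAdd n i)) ∈ p₁.domain ∧
      (fun j => z (Fin.natAdd d j)) ∈ r.domain := fun z => by rw [hq]; rfl
  have hmemq' : ∀ z, z ∈ q'.domain ↔ (fun i => z (Fin.castAdd n i)) ∈ p₂.domain ∧
      (fun j => z (Fin.natAdd d j)) ∈ r'.domain := fun z => by rw [hq']; rfl
  have hmaps : MapsTo ψ r.domain r'.domain := by
    intro w hw
    have hz : Fin.append x₀ w ∈ q.domain := by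
      rw [hmemq]
      simpa using And.intro hx₀ hw
    have hz' : Φ (Fin.append x₀ w) ∈ q'.domain := himg ▸ mem_image_of_mem Φ hz
    rw [hmemq', hfib _ hz] at hz'
    simpa using hz'.2
  -- (2) the scale of the a.e. identity is algebraic
  exact isAlgebraic_of_ae_scaledJacobian r r' c ψ ψ' hψsa hmaps hψ' hae hr

end Summit.KontsevichZagierPeriods.KontsevichZagierPeriods.BetaCancellationLine

end
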